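import Summits.AtomisticToContinuum.HydrodynamicLimit.Theorems.OneFlightGossipEngineCollisionActivityTailsAbnormalActivityTaggedScales
import HarnessLib

/-!
# `CollisionActivityTails` (stmt-AtomisticToContinuum-13734), line `plaque-thinning-count-ld`, stub 5, TAGGED half — file 5/6:
the enlarged tag at the grid time, its measurable majorant and the per-pair one-window bound

Helper file (`--supports stmt-AtomisticToContinuum-13734`) of the crux
`Summit.AtomisticToContinuum.HydrodynamicLimit.Theses.OneFlightGossipEngine.CollisionActivityTails`, line `plaque-thinning-count-ld`,
stub 5 (abnormal activity), TAGGED half `stub_taggedFromLabelEnvelope : LabelEnvelopeFromEnvelope → TaggedFromEnvelope`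
(file `…AbnormalActivityTagged`): under the true local Gibbs law the tagged cold window activity (collisions of particles sitting in an
over-dense or over-heated ball at some scale `≥ K`) is small in mean, from a label-set law envelope of the laws at the times of the
window. Vocabulary: `Tagged`, `tagAct`, `TaggedSmallOn`, `TaggedFromEnvelope`, `imp_le_relSpeed` of `…AbnormalActivity(Hot)` (w-abnormal),
`LabelLawEnvelope`, `LabelEnvelopeOn`, `LabelEnvelopeFromEnvelope` of `…EnvelopePlumbing` (lead), `windowEvent`, `pairTubeSet` of
`…AbnormalActivityStatics`.

This file: §8 the tag READ AT THE GRID TIME. The window inequality compares the mark at a collision with a functional of the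
configuration at the next grid time, reached by the backward FREE FLIGHT OF ALL particles (`hFt`); below a speed cap `U` the centres
move by `≤ U · mesh`, so `tagMark (freeFlight (-t) w) ≤ tagMajor w = |v_k-v_l| (𝟙{∃ j, U < |v_j|} + 𝟙{TaggedPlus})` with the radii of
all scales enlarged by `δ = 2U · mesh` (`tagMark_freeFlight_le`, `Torus.euclidDist_le_euclidDist_translate`); measurability of the
majorant (`measurable_tagMajor`); and the PER-PAIR ONE-WINDOW BOUND `∫ tubePair (𝟙{cap} + 𝟙{TaggedPlus}) dμ ≤ 11 · 2^{-K} C² 4ε²h J`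
for `y ≥ 200 A max(1, β⁻¹)`, `K ≥ 1`, `δ ≤ R_1`, `(N+1)(1 + C c') e^{-λU²} ≤ 2^{-K}` (`lintegral_tubePair_tagMajor_le`, registered helper
sub-goal `stub_taggedPerPair`; cap `2^{-K}`, scales `K + j` summed geometrically `10 · 2^{-K}`).

References: C. Cercignani, R. Illner, M. Pulvirenti, *The Mathematical Theory of Dilute Gases* (1994), §4.3, App. 4.A (collision
cylinders, collision sums along the hard-sphere flow); I. Gallagher, L. Saint-Raymond, B. Texier, *From Newton to Boltzmann* (2013),
Ch. 4. Elementary measure theory and bookkeeping; recorded here.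
-/

noncomputable section

open MeasureTheory Set Filter Topology
open scoped ENNReal

namespace Summit.AtomisticToContinuum.HydrodynamicLimit.Theorems.CollisionActivityTailsAbnormalActivityTagged

open Literature.MathematicalPhysics.KineticTheory Literature.Analysis.FluidPDE
open Summit.AtomisticToContinuum.HydrodynamicLimit.Theorems.CollisionActivityTailsActivityDomination
  (Flow Cfg window act tdist nearCount collisionPairSum_nonneg window_pos)
open Summit.AtomisticToContinuum.HydrodynamicLimit.Theorems.CollisionActivityTailsAbnormalActivityStatics
open Summit.AtomisticToContinuum.HydrodynamicLimit.Theorems.CollisionActivityTailsCrowdedActivityMeasurable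
  (measurable_tdist_config natCast_nearCount)
open Summit.AtomisticToContinuum.HydrodynamicLimit.Theorems.CollisionActivityTailsEndpointTails (ae_mem_good_localGibbsLaw)
-- the tagging vocabulary and the two statements of the tagged half (w-abnormal's reduction file, landed):
open Summit.AtomisticToContinuum.HydrodynamicLimit.Theorems.CollisionActivityTailsAbnormalActivity
  (rec imp relSpeed scaleRadius ballKinetic Tagged tagAct TaggedSmallOn TaggedFromEnvelope imp_le_relSpeed
    hsDiameter_sq_mul_window eventually_window_lt)
-- σ-finiteness of the phase spaces (named instances, landed):
open Summit.AtomisticToContinuum.HydrodynamicLimit.Theorems.MacroBookkeeping (sigmaFinite_volume_phase sigmaFinite_volume_config)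
-- the label-set envelope vocabulary (the lead's plumbing, landed with `stub_labelEnvelopeOn`):
open Summit.AtomisticToContinuum.HydrodynamicLimit.Theorems.CollisionActivityTailsEnvelopePlumbing
  (gaussTupleWeight LabelLawEnvelope LabelEnvelopeOn LabelEnvelopeFromEnvelope)

/-! ## §8 The enlarged tag read at the grid time, its measurable majorant and the per-pair one-window bound -/

section Majorant

variable {N : ℕ}

/-- The count-or-kinetic tag at scale `K'`, with the radius ENLARGED by `δ` (the tag of the collision configuration read on the
configuration at the later grid time: under the backward free flight of all particles, centres move by at most `(speed) × (mesh)`). -/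
def ScaleTag (y δ : ℝ) (K' : ℕ) (w : Cfg N) (k : Fin (N + 1)) : Prop :=
  y * K' ≤ (nearCount w k (scaleRadius N K' + δ) : ℝ) ∨ y * K' ≤ ballKinetic w k (scaleRadius N K' + δ)

/-- ENLARGED TAGGING from the minimal scale `K`: some scale `K + j` carries the enlarged tag. -/
def TaggedPlus (y δ : ℝ) (K : ℕ) (w : Cfg N) (k : Fin (N + 1)) : Prop := ∃ j : ℕ, ScaleTag y δ (K + j) w k

open scoped Classical in
/-- THE TAGGED MARK of an ordered pair: `𝟙{k tagged} |v_k - v_l|` (dominates the tagged cold summand: `|Δv_k| ≤ |v_k - v_l|`). -/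
def tagMark (y : ℝ) (K : ℕ) (w : Cfg N) (k l : Fin (N + 1)) : ℝ≥0∞ :=
  if Tagged y K w k then ENNReal.ofReal ‖(w k).2 - (w l).2‖ else 0

open scoped Classical in
/-- THE MAJORANT of the tagged mark at the grid time: `|v_k - v_l| (𝟙{some speed > U} + 𝟙{TaggedPlus})`. -/
def tagMajor (y δ U : ℝ) (K : ℕ) (w : Cfg N) (k l : Fin (N + 1)) : ℝ≥0∞ :=
  ENNReal.ofReal ‖(w k).2 - (w l).2‖ * ((if ∃ j, U < ‖(w j).2‖ then 1 else 0) + (if TaggedPlus y δ K w k then 1 else 0))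

/-- **Free flight moves minimal-image distances by at most the displacements**: for `t ≥ 0`,
`|x_j - x_k| ≤ |x_j(-t) - x_k(-t)| + t (|v_j| + |v_k|)` (`Torus.euclidDist_le_euclidDist_translate`). -/
theorem tdist_le_tdist_freeFlight_add {t : ℝ} (ht : 0 ≤ t) (w : Cfg N) (j k : Fin (N + 1)) :
    tdist (w j).1 (w k).1 ≤ tdist ((freeFlight (Torus.geometry (Fin 3)) (-t) w j).1) ((freeFlight (Torus.geometry (Fin 3)) (-t) w k).1) +
      t * (‖(w j).2‖ + ‖(w k).2‖) := by
  have h := Torus.euclidDist_le_euclidDist_translate (w j).1 (w k).1 ((-t) • (w j).2) ((-t) • (w k).2)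
  have hn : ‖(-t) • (w j).2 - (-t) • (w k).2‖ ≤ t * (‖(w j).2‖ + ‖(w k).2‖) := by
    rw [← smul_sub, norm_smul, Real.norm_eq_abs, abs_neg, abs_of_nonneg ht]
    exact mul_le_mul_of_nonneg_left (norm_sub_le _ _) ht
  show Torus.euclidDist (w j).1 (w k).1 ≤
    Torus.euclidDist ((w j).1 + Literature.Analysis.FunctionSpaces.Torus.proj ((-t) • (w j).2))
      ((w k).1 + Literature.Analysis.FunctionSpaces.Torus.proj ((-t) • (w k).2)) + t * (‖(w j).2‖ + ‖(w k).2‖)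
  exact h.trans (add_le_add le_rfl hn)

/-- Under a speed cap `U` and for `2 U t ≤ δ`, the near count of the flown configuration at radius `R` is at most the near count at
radius `R + δ`. -/
theorem nearCount_freeFlight_le {U t δ : ℝ} (ht : 0 ≤ t) (htδ : 2 * U * t ≤ δ) {w : Cfg N} (hU : ∀ j, ‖(w j).2‖ ≤ U)
    (k : Fin (N + 1)) (R : ℝ) :
    nearCount (freeFlight (Torus.geometry (Fin 3)) (-t) w) k R ≤ nearCount w k (R + δ) := by
  unfold nearCount
  refine Finset.card_le_card fun j hj => ?_
  rw [Finset.mem_filter] at hj ⊢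
  refine ⟨hj.1, ?_⟩
  calc tdist (w j).1 (w k).1 ≤ _ := tdist_le_tdist_freeFlight_add ht w j k
    _ ≤ R + t * (U + U) := by gcongr; exacts [hj.2, hU j, hU k]
    _ ≤ R + δ := by linarith

/-- Under a speed cap `U` and for `2 U t ≤ δ`, the ball kinetic energy of the flown configuration at radius `R` is at most the one at
radius `R + δ` (same velocities, larger ball). -/
theorem ballKinetic_freeFlight_le {U t δ : ℝ} (ht : 0 ≤ t) (htδ : 2 * U * t ≤ δ) {w : Cfg N} (hU : ∀ j, ‖(w j).2‖ ≤ U)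
    (k : Fin (N + 1)) (R : ℝ) :
    ballKinetic (freeFlight (Torus.geometry (Fin 3)) (-t) w) k R ≤ ballKinetic w k (R + δ) := by
  unfold ballKinetic
  refine Finset.sum_le_sum fun j _ => ?_
  have hv : (freeFlight (Torus.geometry (Fin 3)) (-t) w j).2 = (w j).2 := by simp [freeFlight_apply]
  rw [hv]
  by_cases hj : tdist ((freeFlight (Torus.geometry (Fin 3)) (-t) w j).1) ((freeFlight (Torus.geometry (Fin 3)) (-t) w k).1) ≤ R
  · have hj' : tdist (w j).1 (w k).1 ≤ R + δ := by
      calc tdist (w j).1 (w k).1 ≤ _ := tdist_le_tdist_freeFlight_add ht w j k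
        _ ≤ R + t * (U + U) := by gcongr; exacts [hU j, hU k]
        _ ≤ R + δ := by linarith
    rw [if_pos hj, if_pos hj']
  · rw [if_neg hj]; split_ifs <;> positivity

/-- **DOMINATION ALONG THE BACKWARD FREE FLIGHT** (hypothesis `hFt` of the window inequality): for `0 ≤ t` with `2 U t ≤ δ`, the
tagged mark of the flown configuration is at most the majorant at the grid configuration — either some speed exceeds `U`, or all centres
moved by `≤ U t` and the tag survives at the same scale with radii enlarged by `δ`. -/
theorem tagMark_freeFlight_le {y δ U : ℝ} {K : ℕ} {t : ℝ} (ht : 0 ≤ t) (htδ : 2 * U * t ≤ δ) (w : Cfg N) (k l : Fin (N + 1)) :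
    tagMark y K (freeFlight (Torus.geometry (Fin 3)) (-t) w) k l ≤ tagMajor y δ U K w k l := by
  classical
  unfold tagMark tagMajor
  have hvk : (freeFlight (Torus.geometry (Fin 3)) (-t) w k).2 = (w k).2 := by simp [freeFlight_apply]
  have hvl : (freeFlight (Torus.geometry (Fin 3)) (-t) w l).2 = (w l).2 := by simp [freeFlight_apply]
  rw [hvk, hvl]
  by_cases hT : Tagged y K (freeFlight (Torus.geometry (Fin 3)) (-t) w) k
  · rw [if_pos hT]
    by_cases hcap : ∃ j, U < ‖(w j).2‖
    · rw [if_pos hcap]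
      exact le_mul_of_one_le_right' le_self_add
    · rw [if_neg hcap]
      simp only [not_exists, not_lt] at hcap
      have hplus : TaggedPlus y δ K w k := by
        obtain ⟨K', hKK', -, hor⟩ := hT
        refine ⟨K' - K, ?_⟩
        rw [Nat.add_sub_cancel' hKK']
        rcases hor with hc | hk
        · left
          refine hc.trans ?_
          exact_mod_cast nearCount_freeFlight_le ht htδ hcap k _
        · right
          exact hk.trans (ballKinetic_freeFlight_le ht htδ hcap k _)
      rw [if_pos hplus, zero_add, mul_one]
  · rw [if_neg hT]
    exact bot_le

/-- The real near count is a measurable function of the configuration. -/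
theorem measurable_nearCount_real (k : Fin (N + 1)) (R : ℝ) : Measurable fun w : Cfg N => (nearCount w k R : ℝ) := by
  simp_rw [natCast_nearCount]
  refine Finset.measurable_sum _ fun j _ => Measurable.ite ?_ measurable_const measurable_const
  exact measurableSet_le (measurable_tdist_config j k) measurable_const

/-- The ball kinetic energy is a measurable function of the configuration. -/
theorem measurable_ballKinetic (k : Fin (N + 1)) (R : ℝ) : Measurable fun w : Cfg N => ballKinetic w k R := by
  unfold ballKinetic
  refine Finset.measurable_sum _ fun j _ => Measurable.ite ?_ ((measurable_pi_apply j).snd.norm.pow_const 2) measurable_const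
  exact measurableSet_le (measurable_tdist_config j k) measurable_const

/-- The enlarged scale tag is a measurable event. -/
theorem measurableSet_scaleTag (y δ : ℝ) (K' : ℕ) (k : Fin (N + 1)) : MeasurableSet {w : Cfg N | ScaleTag y δ K' w k} :=
  (measurableSet_le measurable_const (measurable_nearCount_real k _)).union
    (measurableSet_le measurable_const (measurable_ballKinetic k _))

/-- The enlarged tagging is a measurable event. -/
theorem measurableSet_taggedPlus (y δ : ℝ) (K : ℕ) (k : Fin (N + 1)) : MeasurableSet {w : Cfg N | TaggedPlus y δ K w k} := by
  have h : {w : Cfg N | TaggedPlus y δ K w k} = ⋃ j : ℕ, {w : Cfg N | ScaleTag y δ (K + j) w k} := by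
    ext w; simp [TaggedPlus]
  rw [h]
  exact MeasurableSet.iUnion fun j => measurableSet_scaleTag y δ (K + j) k

/-- The speed-cap event is measurable. -/
theorem measurableSet_cap (U : ℝ) : MeasurableSet {w : Cfg N | ∃ j, U < ‖(w j).2‖} := by
  have h : {w : Cfg N | ∃ j, U < ‖(w j).2‖} = ⋃ j, {w : Cfg N | U < ‖(w j).2‖} := by ext w; simp
  rw [h]
  exact MeasurableSet.iUnion fun j => measurableSet_lt measurable_const (measurable_pi_apply j).snd.norm

/-- The majorant is a measurable function of the configuration (hypothesis `hFtm` of the window inequality). -/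
theorem measurable_tagMajor (y δ U : ℝ) (K : ℕ) (k l : Fin (N + 1)) : Measurable fun w : Cfg N => tagMajor y δ U K w k l := by
  classical
  unfold tagMajor
  refine ((measurable_pi_apply k).snd.sub (measurable_pi_apply l).snd).norm.ennreal_ofReal.mul ?_
  exact (Measurable.ite (measurableSet_cap U) measurable_const measurable_const).add
    (Measurable.ite (measurableSet_taggedPlus y δ K k) measurable_const measurable_const)

open scoped Classical in
/-- The enlarged-tag indicator is at most the sum over the scales of the count and kinetic indicators. -/
theorem taggedPlusInd_le_tsum (y δ : ℝ) (K : ℕ) (w : Cfg N) (k : Fin (N + 1)) :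
    (if TaggedPlus y δ K w k then (1 : ℝ≥0∞) else 0) ≤
      ∑' j : ℕ, ((if y * (K + j : ℕ) ≤ (nearCount w k (scaleRadius N (K + j) + δ) : ℝ) then (1 : ℝ≥0∞) else 0) +
        (if y * (K + j : ℕ) ≤ ballKinetic w k (scaleRadius N (K + j) + δ) then (1 : ℝ≥0∞) else 0)) := by
  split_ifs with h
  · obtain ⟨j, hj⟩ := h
    refine le_trans ?_ (ENNReal.le_tsum j)
    rcases hj with hc | hk
    · rw [if_pos hc]; exact le_self_add
    · rw [if_pos hk]; exact le_add_self
  · exact bot_le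

open scoped Classical in
/-- **THE PER-PAIR ONE-WINDOW BOUND OF THE TAGGED HALF** under a label-set envelope: with `A = C(2π/β)^{3/2} ≥ 1`, threshold
`y ≥ 200 A max(1, β⁻¹)`, minimal scale `K ≥ 1`, enlargement `0 ≤ δ ≤ R_1`, and a speed cap `U ≥ 0` so large that
`(N+1)(1 + C c') e^{-λU²} ≤ 2^{-K}`:
`∫ tubePair(w_k, w_l) (𝟙{cap} + 𝟙{TaggedPlus}) dμ ≤ 11 · 2^{-K} · C² · 4ε²h · J`
(cap `2^{-K}`; scales `K + j`: count `4 · 2^{-(K+j)}` + kinetic `2^{-(K+j)}`, geometric sum `= 10 · 2^{-K}`). -/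
theorem lintegral_tubePair_tagMajor_le {μ : Measure (Cfg N)} {C β : ℝ} (hC : 0 ≤ C) (hβ : 0 < β)
    (hμ : LabelLawEnvelope μ C β) {k l : Fin (N + 1)} (hkl : k ≠ l) {S : V3 → Set V3}
    (hSm : MeasurableSet {q : V3 × V3 | q.1 ∈ S q.2}) {ε h : ℝ} (hεh : 0 ≤ 4 * ε ^ 2 * h)
    (hSvol : ∀ u, volume (S u) ≤ ENNReal.ofReal (4 * ε ^ 2 * h * ‖u‖))
    (hA : 1 ≤ C * (2 * Real.pi / β) ^ (3 / 2 : ℝ)) {y : ℝ} (hy : 200 * (C * (2 * Real.pi / β) ^ (3 / 2 : ℝ)) * max 1 β⁻¹ ≤ y)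
    {K : ℕ} (hK : 1 ≤ K) {δ : ℝ} (hδ : 0 ≤ δ) (hδR : δ ≤ scaleRadius N 1) {U : ℝ} (hU : 0 ≤ U)
    (hUcap : ((N : ℝ≥0∞) + 1) * (1 + ENNReal.ofReal C * ENNReal.ofReal ((2 * Real.pi / (β / 2)) ^ (3 / 2 : ℝ))) *
      ENNReal.ofReal (Real.exp (-(β / 4 * U ^ 2))) ≤ 2⁻¹ ^ K) :
    ∫⁻ w, tubePair S (w k) (w l) *
        ((if ∃ j, U < ‖(w j).2‖ then 1 else 0) + (if TaggedPlus y δ K w k then 1 else 0)) ∂μ ≤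
      11 * 2⁻¹ ^ K * (ENNReal.ofReal (C ^ 2) * (ENNReal.ofReal (4 * ε ^ 2 * h) * fluxJ β)) := by
  classical
  set A : ℝ := C * (2 * Real.pi / β) ^ (3 / 2 : ℝ) with hAdef
  set Q : ℝ≥0∞ := ENNReal.ofReal (C ^ 2) * (ENNReal.ofReal (4 * ε ^ 2 * h) * fluxJ β) with hQ
  have hA0 : 0 < A := one_pos.trans_le hA
  have hy1 : 100 * A ≤ y := by
    have : 200 * A * 1 ≤ 200 * A * max 1 β⁻¹ := by gcongr; exact le_max_left _ _
    nlinarith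
  have hy2 : 200 * A * β⁻¹ ≤ y := le_trans (by gcongr; exact le_max_right _ _) hy
  have htw := measurable_tubePair_cfg hSm k l (N := N)
  -- the cap
  have hcap : ∫⁻ w, tubePair S (w k) (w l) * (if ∃ j, U < ‖(w j).2‖ then 1 else 0) ∂μ ≤ 2⁻¹ ^ K * Q := by
    refine (lintegral_tubePair_cap_le hC hβ hμ hkl hSm hεh hSvol hU).trans ?_
    calc ((N : ℝ≥0∞) + 1) * (ENNReal.ofReal (C ^ 2) * max 1 (ENNReal.ofReal C * ENNReal.ofReal ((2 * Real.pi / (β / 2)) ^ (3 / 2 : ℝ))) *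
          ENNReal.ofReal (Real.exp (-(β / 4 * U ^ 2))) * (ENNReal.ofReal (4 * ε ^ 2 * h) * fluxJ β))
        ≤ ((N : ℝ≥0∞) + 1) * (ENNReal.ofReal (C ^ 2) * (1 + ENNReal.ofReal C * ENNReal.ofReal ((2 * Real.pi / (β / 2)) ^ (3 / 2 : ℝ))) *
          ENNReal.ofReal (Real.exp (-(β / 4 * U ^ 2))) * (ENNReal.ofReal (4 * ε ^ 2 * h) * fluxJ β)) := by
          gcongr
          exact max_le le_self_add le_add_self
      _ = ((N : ℝ≥0∞) + 1) * (1 + ENNReal.ofReal C * ENNReal.ofReal ((2 * Real.pi / (β / 2)) ^ (3 / 2 : ℝ))) *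
          ENNReal.ofReal (Real.exp (-(β / 4 * U ^ 2))) * Q := by rw [hQ]; ring
      _ ≤ 2⁻¹ ^ K * Q := by gcongr
  -- the scales
  set cI : ℕ → Cfg N → ℝ≥0∞ := fun j w =>
    if y * (K + j : ℕ) ≤ (nearCount w k (scaleRadius N (K + j) + δ) : ℝ) then 1 else 0 with hcI
  set kI : ℕ → Cfg N → ℝ≥0∞ := fun j w =>
    if y * (K + j : ℕ) ≤ ballKinetic w k (scaleRadius N (K + j) + δ) then 1 else 0 with hkI
  have hcIm : ∀ j, Measurable (cI j) := fun j =>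
    Measurable.ite (measurableSet_le measurable_const (measurable_nearCount_real k _)) measurable_const measurable_const
  have hkIm : ∀ j, Measurable (kI j) := fun j =>
    Measurable.ite (measurableSet_le measurable_const (measurable_ballKinetic k _)) measurable_const measurable_const
  have hscale : ∀ j : ℕ, ∫⁻ w, tubePair S (w k) (w l) * (cI j w + kI j w) ∂μ ≤ 5 * 2⁻¹ ^ (K + j) * Q := by
    intro j
    have hKj : 1 ≤ K + j := le_add_right hK
    have hδR' : δ ≤ scaleRadius N (K + j) := hδR.trans (scaleRadius_mono N hKj)
    have h1 := lintegral_tubePair_countScale_le hC hβ hμ hkl hSm hεh hSvol hA hy1 hKj hδ hδR'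
    have h2 := lintegral_tubePair_kineticScale_le hC hβ hμ hkl hSm hεh hSvol hA hy2 hKj hδ hδR'
    calc ∫⁻ w, tubePair S (w k) (w l) * (cI j w + kI j w) ∂μ
        = ∫⁻ w, tubePair S (w k) (w l) * cI j w ∂μ + ∫⁻ w, tubePair S (w k) (w l) * kI j w ∂μ := by
          simp_rw [mul_add]
          exact lintegral_add_left (htw.mul (hcIm j)) _
      _ ≤ 4 * 2⁻¹ ^ (K + j) * Q + 2⁻¹ ^ (K + j) * Q := add_le_add h1 h2
      _ = 5 * 2⁻¹ ^ (K + j) * Q := by ring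
  have htag : ∫⁻ w, tubePair S (w k) (w l) * (if TaggedPlus y δ K w k then 1 else 0) ∂μ ≤ 10 * 2⁻¹ ^ K * Q := by
    calc ∫⁻ w, tubePair S (w k) (w l) * (if TaggedPlus y δ K w k then 1 else 0) ∂μ
        ≤ ∫⁻ w, ∑' j, tubePair S (w k) (w l) * (cI j w + kI j w) ∂μ := by
          refine lintegral_mono fun w => ?_
          rw [ENNReal.tsum_mul_left]
          exact mul_le_mul' le_rfl (taggedPlusInd_le_tsum y δ K w k)
      _ = ∑' j, ∫⁻ w, tubePair S (w k) (w l) * (cI j w + kI j w) ∂μ :=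
          lintegral_tsum fun j => (htw.mul ((hcIm j).add (hkIm j))).aemeasurable
      _ ≤ ∑' j, 5 * 2⁻¹ ^ (K + j) * Q := ENNReal.tsum_le_tsum hscale
      _ = 5 * 2⁻¹ ^ K * Q * ∑' j : ℕ, (2⁻¹ : ℝ≥0∞) ^ j := by
          rw [← ENNReal.tsum_mul_left]; congr 1; funext j; rw [pow_add]; ring
      _ = 10 * 2⁻¹ ^ K * Q := by
          rw [ENNReal.tsum_geometric, ENNReal.one_sub_inv_two, inv_inv]; ring
  -- total
  calc ∫⁻ w, tubePair S (w k) (w l) * ((if ∃ j, U < ‖(w j).2‖ then 1 else 0) + (if TaggedPlus y δ K w k then 1 else 0)) ∂μ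
      = ∫⁻ w, tubePair S (w k) (w l) * (if ∃ j, U < ‖(w j).2‖ then 1 else 0) ∂μ +
          ∫⁻ w, tubePair S (w k) (w l) * (if TaggedPlus y δ K w k then 1 else 0) ∂μ := by
        simp_rw [mul_add]
        exact lintegral_add_left (htw.mul (Measurable.ite (measurableSet_cap U) measurable_const measurable_const)) _
    _ ≤ 2⁻¹ ^ K * Q + 10 * 2⁻¹ ^ K * Q := add_le_add hcap htag
    _ = 11 * 2⁻¹ ^ K * Q := by ring

open scoped Classical in
/-- **Helper sub-goal `stub_taggedPerPair`** (line `plaque-thinning-count-ld`, stub 5, tagged half, file 5): the per-pair one-window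
bound of the tagged half under a label-set law envelope (`lintegral_tubePair_tagMajor_le`, closed form). -/
theorem stub_taggedPerPair : ∀ {N : ℕ} {μ : Measure (Cfg N)} {C β : ℝ}, 0 ≤ C → 0 < β → LabelLawEnvelope μ C β → ∀ {k l : Fin (N + 1)}, k ≠ l → ∀ {S : V3 → Set V3}, MeasurableSet {q : V3 × V3 | q.1 ∈ S q.2} → ∀ {ε h : ℝ}, 0 ≤ 4 * ε ^ 2 * h → (∀ u, volume (S u) ≤ ENNReal.ofReal (4 * ε ^ 2 * h * ‖u‖)) → 1 ≤ C * (2 * Real.pi / β) ^ (3 / 2 : ℝ) → ∀ {y : ℝ}, 200 * (C * (2 * Real.pi / β) ^ (3 / 2 : ℝ)) * max 1 β⁻¹ ≤ y → ∀ {K : ℕ}, 1 ≤ K → ∀ {δ : ℝ}, 0 ≤ δ → δ ≤ scaleRadius N 1 → ∀ {U : ℝ}, 0 ≤ U → ((N : ℝ≥0∞) + 1) * (1 + ENNReal.ofReal C * ENNReal.ofReal ((2 * Real.pi / (β / 2)) ^ (3 / 2 : ℝ))) * ENNReal.ofReal (Real.exp (-(β / 4 * U ^ 2))) ≤ 2⁻¹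 ^ K → ∫⁻ w, tubePair S (w k) (w l) * ((if ∃ j, U < ‖(w j).2‖ then 1 else 0) + (if TaggedPlus y δ K w k then 1 else 0)) ∂μ ≤ 11 * 2⁻¹ ^ K * (ENNReal.ofReal (C ^ 2) * (ENNReal.ofReal (4 * ε ^ 2 * h) * fluxJ β)) :=
  fun hC hβ hμ _ _ hkl _ hSm _ _ hεh hSvol hA _ hy _ hK _ hδ hδR _ hU hUcap =>
    lintegral_tubePair_tagMajor_le hC hβ hμ hkl hSm hεh hSvol hA hy hK hδ hδR hU hUcap

end Majorant

end Summit.AtomisticToContinuum.HydrodynamicLimit.Theorems.CollisionActivityTailsAbnormalActivityTagged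

end
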